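import Mathlib
import HarnessLib
import Summits.ValiantsHypothesis.ValiantsHypothesis.Theses.MonotoneRestoration
import Literature.Computability.AlgebraicComplexity.ArithCircuit
import Literature.Computability.AlgebraicComplexity.ArithCircuitProofs
import Literature.Computability.AlgebraicComplexity.MonotoneStructure
import Literature.Computability.AlgebraicComplexity.PermanentIrreducible
import Literature.ModelTheory.FiniteModelTheory.CkEquiv
import Summits.ValiantsHypothesis.ValiantsHypothesis.Theorems.MonotoneRestorationMonotoneRestorationQPCosetCount
import Summits.ValiantsHypothesis.ValiantsHypothesis.Theorems.MonotoneRestorationMonotoneRestorationQPSymmetricLB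
import Summits.ValiantsHypothesis.ValiantsHypothesis.Theorems.MonotoneRestorationMonotoneRestorationQPSupportSymmetrisation
import Summits.ValiantsHypothesis.ValiantsHypothesis.Theorems.MonotoneRestorationMonotoneRestorationQPSparseRegime
import Summits.ValiantsHypothesis.ValiantsHypothesis.Theorems.MonotoneRestorationMonotoneRestorationQPBeta
import Literature.Computability.AlgebraicComplexity.SymmetricArithCircuit
import Literature.Computability.AlgebraicComplexity.DawarWilsenach2025Proofs
import Literature.GroupTheory.PermutationGroups.SmallIndexSubgroups
import Summits.ValiantsHypothesis.ValiantsHypothesis.Theorems.MonotoneRestorationQP.Negative.LoadBearing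
import Summits.ValiantsHypothesis.ValiantsHypothesis.Theorems.MonotoneRestorationMonotoneRestorationQPPermSupportCount

/-! TTRL-lite variant V19394 of stmt-ValiantsHypothesis-15886 -/

namespace Summit.ValiantsHypothesis.ValiantsHypothesis.Theorems

open Summit.ValiantsHypothesis.ValiantsHypothesis.Theses.MonotoneRestoration
open Literature.Computability.AlgebraicComplexity

/-- TTRL-lite variant V19394 of `stub_gammaArithmetic` (stmt-ValiantsHypothesis-15886): the inductive
step of the kernel bound `2 ^ k ≤ n.choose k`.  From `2 (k+1) ≤ n+1` and `2^k ≤ C(n,k)` we get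
`(k+1) · 2^(k+1) = 2(k+1) · 2^k ≤ (n+1) · C(n,k) = C(n+1,k+1) · (k+1)` (`Nat.add_one_mul_choose_eq`),
and cancelling the positive factor `k+1` gives `2^(k+1) ≤ C(n+1,k+1)`. -/
theorem stub_gammaArithmetic_var19394 :
    ∀ (n k : ℕ), 2 * (k + 1) ≤ n + 1 → 2 ^ k ≤ n.choose k →
      2 ^ (k + 1) ≤ (n + 1).choose (k + 1) := by
  intro n k hk hih
  have h : (n + 1) * n.choose k = (n + 1).choose (k + 1) * (k + 1) :=
    Nat.add_one_mul_choose_eq n k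
  have hmul : (k + 1) * 2 ^ (k + 1) ≤ (k + 1) * (n + 1).choose (k + 1) := by
    calc (k + 1) * 2 ^ (k + 1) = 2 * (k + 1) * 2 ^ k := by ring
      _ ≤ (n + 1) * n.choose k := Nat.mul_le_mul hk hih
      _ = (n + 1).choose (k + 1) * (k + 1) := h
      _ = (k + 1) * (n + 1).choose (k + 1) := Nat.mul_comm _ _
  exact Nat.le_of_mul_le_mul_left hmul (Nat.succ_pos k)

end Summit.ValiantsHypothesis.ValiantsHypothesis.Theorems
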